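import Literature.RepresentationTheory.Kovacevic2021.SU21WeightedForms
import HarnessLib

/-!
# A unitarizability criterion for Kovačević's `K`-type data: weights solving the arrow recursions

Continuation of `Literature.RepresentationTheory.Kovacevic2021.SU21WeightedForms` (the weighted Hermitian form
`⟨v, w⟩_c = Σ_t c_t conj(v_t) w_t` on `𝒟.V` and the reduction of invariance to matrix entries,
`weightForm_comm_of_entries`).  [Kovacevic2021, §4, proof of Thm 4] normalises an invariant Hermitian form on a
`(𝔤,K)`-module of `SU(2,1)` `K`-type by `K`-type and reads off, along each arrow, a sign condition ("the form is
positive iff `a d < 0`, `b c < 0`").  In the basis `u^k_{n,m}` of `SU21ModulesFromKTypes` this becomes the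
following statement, proved here for an ARBITRARY datum (`isUnitarizable_of_weights`): if positive weights
`c(n,m,k)` on the admissible labels satisfy

* the `𝔨`-condition `c(n,m,k+1) = k(n-k) c(n,m,k)` (`1 ≤ k < n`; unitarity of `𝔨 ≅ 𝔲(2) ⊕ 𝔲(1)`),
* the `A`–`D` edge condition `(n+1-k) conj(A_{n,m}) c(n+1,m+3,k) = -D_{n+1,m+3} c(n,m,k)` (`1 ≤ k ≤ n`),
* the `B`–`C` edge condition `conj(C_{n,m}) c(n-1,m+3,k) = -(n-k) B_{n-1,m+3} c(n,m,k)` (`1 ≤ k ≤ n-1`),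

then the weighted form is `𝔰𝔲(2,1)`-invariant (`⟨E_{ij} v, w⟩_c = ε_i ε_j ⟨v, E_{ji} w⟩_c`, `ε = (1,1,-1)`), so
the datum is unitarizable in the sense of `SU21Unitarity.IsUnitarizable`.  The proof computes the matrix entries
of the eight operators in the basis `u^k_{n,m}` (§1), checks the entry condition of `weightForm_comm_of_entries`
for `E₀₁ ↦ X_α`, `E₀₂ ↦ X_{α+β}`, `E₁₂ ↦ X_β` and the diagonal `E_{ii}` (§2), and obtains the transposed cases
`E₁₀, E₂₀, E₂₁` from Hermitian symmetry (`weightForm_lie_comm_symm`).  The sequels `SU21UnitarityRays` /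
`SU21UnitarityCone` solve the recursions on the five non-trivial cohomological modules.
Theorems only (plus the bookkeeping definition `labelWeight`); no named facts.

## References

* D. Kovačević, *Unitary `(𝔤,K)` modules of `SU(2,1)`*, Acta Math. Spalatensia 1 (2021) 105–125
  (arXiv:1810.01752): §2, §4 Thm 4 and its proof. [Kovacevic2021]
* A. Borel, N. Wallach (2000), VI Thm 4.12 (2) p. 133. [BorelWallach2000]
-/

noncomputable section

open Finsupp

namespace Literature.RepresentationTheory.Kovacevic2021

-- Mathlib idiom (Mathlib/Algebra/Lie/OfAssociative.lean): commutator brackets on associative algebras; needed for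
-- the `𝔤𝔩(3,ℂ)`-module structure on `𝒟.V`, as in every file of this directory.
attribute [local instance 100] LieRing.ofAssociativeRing

namespace SU21Datum

variable (𝒟 : SU21Datum)

/-! ## §1 Matrix entries of the eight operators in the basis `u^k_{n,m}` -/

/-- the coordinate of `u^k_{n,m}` at an explicit label `(n',m',k')` (cf. `vec_apply`) [cite: Kovacevic2021, §3 Def 1] -/
theorem vec_apply_mk (n m k n' m' k' : ℤ) (h' : (n', m') ∈ 𝒟.S ∧ 1 ≤ k' ∧ k' ≤ n') :
    𝒟.vec n m k ⟨(n', m', k'), h'⟩ = if n' = n ∧ m' = m ∧ k' = k then 1 else 0 := by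
  rw [vec_apply]
  simp only [Prod.mk.injEq]
  split_ifs <;> first | rfl | (exfalso; omega)

variable {𝒟}

/-- entries of `X_α`: `(X_α)_{(n,m,k-1),(n,m,k)} = -(k-1)(n+1-k)` [cite: Kovacevic2021, §3 Def 1] -/
theorem Xa_entry (n m k n' m' k' : ℤ) (h' : (n', m') ∈ 𝒟.S ∧ 1 ≤ k' ∧ k' ≤ n') :
    𝒟.Xa (𝒟.vec n m k) ⟨(n', m', k'), h'⟩
      = if n' = n ∧ m' = m ∧ k' = k - 1 then -(((k : ℂ) - 1) * ((n : ℂ) + 1 - k)) else 0 := by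
  rw [Xa_vec, Finsupp.smul_apply, vec_apply_mk, smul_eq_mul, mul_ite, mul_one, mul_zero]

/-- entries of `Y_α`: `(Y_α)_{(n,m,k+1),(n,m,k)} = -1` [cite: Kovacevic2021, §3 Def 1] -/
theorem Ya_entry (n m : ℤ) {k : ℤ} (hk : 1 ≤ k) (n' m' k' : ℤ) (h' : (n', m') ∈ 𝒟.S ∧ 1 ≤ k' ∧ k' ≤ n') :
    𝒟.Ya (𝒟.vec n m k) ⟨(n', m', k'), h'⟩ = -(if n' = n ∧ m' = m ∧ k' = k + 1 then (1 : ℂ) else 0) := by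
  rw [Ya_vec n m hk, Finsupp.neg_apply, vec_apply_mk]

/-- entries of `X_{α+β}`: `(n+1-k) A_{n,m}` at `(n+1,m+3,k)` and `(k-1) C_{n,m}` at `(n-1,m+3,k-1)`
[cite: Kovacevic2021, §3 Thm 1] -/
theorem Xab_entry (n m k n' m' k' : ℤ) (h' : (n', m') ∈ 𝒟.S ∧ 1 ≤ k' ∧ k' ≤ n') :
    𝒟.Xab (𝒟.vec n m k) ⟨(n', m', k'), h'⟩
      = (if n' = n + 1 ∧ m' = m + 3 ∧ k' = k then ((n : ℂ) + 1 - k) * 𝒟.A n m else 0)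
        + (if n' = n - 1 ∧ m' = m + 3 ∧ k' = k - 1 then ((k : ℂ) - 1) * 𝒟.C n m else 0) := by
  rw [Xab_vec, Finsupp.add_apply, Finsupp.smul_apply, Finsupp.smul_apply, vec_apply_mk, vec_apply_mk, smul_eq_mul,
    smul_eq_mul, mul_ite, mul_ite, mul_one, mul_zero, mul_one, mul_zero]

/-- entries of `X_β`: `-A_{n,m}` at `(n+1,m+3,k+1)` and `C_{n,m}` at `(n-1,m+3,k)` [cite: Kovacevic2021, §3 Thm 1] -/
theorem Xb_entry (n m : ℤ) {k : ℤ} (hk : 1 ≤ k) (n' m' k' : ℤ) (h' : (n', m') ∈ 𝒟.S ∧ 1 ≤ k' ∧ k' ≤ n') :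
    𝒟.Xb (𝒟.vec n m k) ⟨(n', m', k'), h'⟩
      = (if n' = n + 1 ∧ m' = m + 3 ∧ k' = k + 1 then -𝒟.A n m else 0)
        + (if n' = n - 1 ∧ m' = m + 3 ∧ k' = k then 𝒟.C n m else 0) := by
  rw [Xb_vec n m hk, Finsupp.add_apply, Finsupp.smul_apply, Finsupp.smul_apply, vec_apply_mk, vec_apply_mk,
    smul_eq_mul, smul_eq_mul, mul_ite, mul_ite, mul_one, mul_zero, mul_one, mul_zero]

/-- entries of `Y_{α+β}`: `B_{n,m}` at `(n+1,m-3,k+1)` and `D_{n,m}` at `(n-1,m-3,k)` [cite: Kovacevic2021, §3 Thm 1] -/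
theorem Yab_entry (n m : ℤ) {k : ℤ} (hk : 1 ≤ k) (n' m' k' : ℤ) (h' : (n', m') ∈ 𝒟.S ∧ 1 ≤ k' ∧ k' ≤ n') :
    𝒟.Yab (𝒟.vec n m k) ⟨(n', m', k'), h'⟩
      = (if n' = n + 1 ∧ m' = m - 3 ∧ k' = k + 1 then 𝒟.B n m else 0)
        + (if n' = n - 1 ∧ m' = m - 3 ∧ k' = k then 𝒟.D n m else 0) := by
  rw [Yab_vec n m hk, Finsupp.add_apply, Finsupp.smul_apply, Finsupp.smul_apply, vec_apply_mk, vec_apply_mk,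
    smul_eq_mul, smul_eq_mul, mul_ite, mul_ite, mul_one, mul_zero, mul_one, mul_zero]

/-- entries of `Y_β`: `(n+1-k) B_{n,m}` at `(n+1,m-3,k)` and `-(k-1) D_{n,m}` at `(n-1,m-3,k-1)`
[cite: Kovacevic2021, §3 Thm 1] -/
theorem Yb_entry (n m k n' m' k' : ℤ) (h' : (n', m') ∈ 𝒟.S ∧ 1 ≤ k' ∧ k' ≤ n') :
    𝒟.Yb (𝒟.vec n m k) ⟨(n', m', k'), h'⟩
      = (if n' = n + 1 ∧ m' = m - 3 ∧ k' = k then ((n : ℂ) + 1 - k) * 𝒟.B n m else 0)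
        + (if n' = n - 1 ∧ m' = m - 3 ∧ k' = k - 1 then -(((k : ℂ) - 1) * 𝒟.D n m) else 0) := by
  rw [Yb_vec, Finsupp.add_apply, Finsupp.smul_apply, Finsupp.smul_apply, vec_apply_mk, vec_apply_mk, smul_eq_mul,
    smul_eq_mul, mul_ite, mul_ite, mul_one, mul_zero, mul_one, mul_zero]

/-- entries of a diagonal operator `a H_α + b H_β`: eigenvalue `a(n+1-2k) + b(m-n-1+2k)/2` on `u^k_{n,m}`
[cite: Kovacevic2021, §3 Def 1] -/
theorem diag_entry (a b : ℂ) (n m k n' m' k' : ℤ) (h' : (n', m') ∈ 𝒟.S ∧ 1 ≤ k' ∧ k' ≤ n') :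
    (a • 𝒟.Ha + b • 𝒟.Hb) (𝒟.vec n m k) ⟨(n', m', k'), h'⟩
      = if n' = n ∧ m' = m ∧ k' = k
        then a * ((n : ℂ) + 1 - 2 * k) + b * (((m : ℂ) - n - 1 + 2 * k) / 2) else 0 := by
  rw [LinearMap.add_apply, LinearMap.smul_apply, LinearMap.smul_apply, Ha_vec, Hb_vec, smul_smul, smul_smul,
    ← add_smul, Finsupp.smul_apply, vec_apply_mk, smul_eq_mul, mul_ite, mul_one, mul_zero]

/-! ## §2 Invariance of a weighted form from the three recursions -/

/-- the signs: `ε₀ = 1` [cite: Kovacevic2021, §2] -/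
theorem suSign_zero : suSign 0 = 1 := if_neg (by decide)
/-- `ε₁ = 1` [cite: Kovacevic2021, §2] -/
theorem suSign_one : suSign 1 = 1 := if_neg (by decide)
/-- `ε₂ = -1` [cite: Kovacevic2021, §2] -/
theorem suSign_two : suSign 2 = -1 := if_pos rfl
/-- the signs are real [cite: Kovacevic2021, §2] -/
theorem conj_suSign (i : Fin 3) : starRingEnd ℂ (suSign i) = suSign i := by
  unfold suSign; split_ifs
  · rw [map_neg, map_one]
  · rw [map_one]
/-- `ε_i² = 1` [cite: Kovacevic2021, §2] -/
theorem suSign_mul_self (i : Fin 3) : suSign i * suSign i = 1 := by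
  unfold suSign; split_ifs <;> norm_num

variable (𝒟)

/-- the weight of the label `(n,m,k)` read from a function of three integers [cite: Kovacevic2021, §4 proof of Thm 4] -/
def labelWeight (c : ℤ → ℤ → ℤ → ℝ) : 𝒟.Idx → ℝ := fun t => c t.1.1 t.1.2.1 t.1.2.2

/-- unfolding `labelWeight` on a label [cite: Kovacevic2021, §4 proof of Thm 4] -/
@[simp] theorem labelWeight_mk (c : ℤ → ℤ → ℤ → ℝ) (n m k : ℤ) (h : (n, m) ∈ 𝒟.S ∧ 1 ≤ k ∧ k ≤ n) :
    𝒟.labelWeight c ⟨(n, m, k), h⟩ = c n m k := rfl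

variable {𝒟}
variable {c : ℤ → ℤ → ℤ → ℝ}

/-- **Hermitian symmetry transports an adjointness relation to the transposed pair**: if
`⟨X v, w⟩ = ε ⟨v, Y w⟩` for all `v, w` (`ε` real, `ε² = 1`) then `⟨Y v, w⟩ = ε ⟨v, X w⟩`.
[cite: Kovacevic2021, §4 proof of Thm 4] -/
theorem comm_symm (w : 𝒟.Idx → ℝ) {X Y : Module.End ℂ 𝒟.V} {ε : ℂ} (hε : starRingEnd ℂ ε = ε)
    (hε2 : ε * ε = 1) (h : ∀ v u, 𝒟.weightForm w (X v) u = ε * 𝒟.weightForm w v (Y u)) (v u : 𝒟.V) :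
    𝒟.weightForm w (Y v) u = ε * 𝒟.weightForm w v (X u) := by
  rw [𝒟.weightForm_conj_symm w (Y v) u, 𝒟.weightForm_conj_symm w v (X u), h u v, map_mul, hε, ← mul_assoc,
    hε2, one_mul]

/-- the same for the matrix units: `⟨E_{ij} v, w⟩ = ε_i ε_j ⟨v, E_{ji} w⟩` for all `v, w` implies
`⟨E_{ji} v, w⟩ = ε_j ε_i ⟨v, E_{ij} w⟩` [cite: Kovacevic2021, §4 proof of Thm 4] -/
theorem weightForm_lie_comm_symm (w : 𝒟.Idx → ℝ) {i j : Fin 3}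
    (h : ∀ v u : 𝒟.V, 𝒟.weightForm w ⁅E i j, v⁆ u = suSign i * suSign j * 𝒟.weightForm w v ⁅E j i, u⁆)
    (v u : 𝒟.V) :
    𝒟.weightForm w ⁅E j i, v⁆ u = suSign j * suSign i * 𝒟.weightForm w v ⁅E i j, u⁆ := by
  rw [mul_comm (suSign j)]
  have hε : starRingEnd ℂ (suSign i * suSign j) = suSign i * suSign j := by
    rw [map_mul, conj_suSign, conj_suSign]
  have hε2 : (suSign i * suSign j) * (suSign i * suSign j) = 1 := by
    rw [mul_mul_mul_comm, suSign_mul_self, suSign_mul_self, one_mul]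
  simp only [lie_def] at h ⊢
  exact comm_symm w hε hε2 h v u

/-- the `𝔨`-condition, complexified: `c(n,m,k+1) = k(n-k) c(n,m,k)` [cite: Kovacevic2021, §4 proof of Thm 4] -/
theorem hk_complex
    (hk : ∀ n m k, (n, m) ∈ 𝒟.S → 1 ≤ k → k < n → c n m (k + 1) = k * (n - k) * c n m k)
    {n m k : ℤ} (hS : (n, m) ∈ 𝒟.S) (h1 : 1 ≤ k) (h2 : k < n) :
    (c n m (k + 1) : ℂ) = (k : ℂ) * ((n : ℂ) - k) * c n m k := by
  have := hk n m k hS h1 h2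
  rw [this]; push_cast; ring

/-- `E₀₁ ↦ X_α`, `E₁₀ ↦ Y_α`: `⟨X_α v, w⟩_c = ⟨v, Y_α w⟩_c` from the `𝔨`-condition
[cite: Kovacevic2021, §4 proof of Thm 4] -/
theorem weightForm_Xa_comm
    (hk : ∀ n m k, (n, m) ∈ 𝒟.S → 1 ≤ k → k < n → c n m (k + 1) = k * (n - k) * c n m k) (v u : 𝒟.V) :
    𝒟.weightForm (𝒟.labelWeight c) (𝒟.Xa v) u
      = (suSign 0 * suSign 1) * 𝒟.weightForm (𝒟.labelWeight c) v (𝒟.Ya u) := by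
  refine 𝒟.weightForm_comm_of_entries _ 𝒟.Xa 𝒟.Ya _ (fun s t => ?_) v u
  obtain ⟨⟨n, m, k⟩, hS, hk1, hkn⟩ := s
  obtain ⟨⟨n', m', k'⟩, hS', hk1', hkn'⟩ := t
  dsimp only at hS hk1 hkn hS' hk1' hkn'
  rw [← vec_of_pos n m k ⟨hS, hk1, hkn⟩, ← vec_of_pos n' m' k' ⟨hS', hk1', hkn'⟩, Xa_entry,
    Ya_entry n' m' hk1', labelWeight_mk, labelWeight_mk, suSign_zero, suSign_one, one_mul, one_mul]
  split_ifs
  any_goals (exfalso; omega)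
  · obtain ⟨e1, e2, e3⟩ : n' = n ∧ m' = m ∧ k' = k - 1 := by assumption
    subst n' m' k'
    have e := hk_complex hk hS hk1' (by omega)
    rw [sub_add_cancel] at e
    rw [map_neg, map_mul, map_sub, map_sub, map_add, map_one, map_intCast, map_intCast]
    push_cast at e ⊢
    linear_combination e
  · simp

/-- `E₀₂ ↦ X_{α+β}`, `E₂₀ ↦ Y_{α+β}`: `⟨X_{α+β} v, w⟩_c = -⟨v, Y_{α+β} w⟩_c` from the two edge conditions
(and the `𝔨`-condition) [cite: Kovacevic2021, §4 proof of Thm 4] -/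
theorem weightForm_Xab_comm
    (hk : ∀ n m k, (n, m) ∈ 𝒟.S → 1 ≤ k → k < n → c n m (k + 1) = k * (n - k) * c n m k)
    (hAD : ∀ n m k, (n, m) ∈ 𝒟.S → (n + 1, m + 3) ∈ 𝒟.S → 1 ≤ k → k ≤ n →
      ((n : ℂ) + 1 - k) * starRingEnd ℂ (𝒟.A n m) * c (n + 1) (m + 3) k = -𝒟.D (n + 1) (m + 3) * c n m k)
    (hBC : ∀ n m k, (n, m) ∈ 𝒟.S → (n - 1, m + 3) ∈ 𝒟.S → 1 ≤ k → k ≤ n - 1 →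
      starRingEnd ℂ (𝒟.C n m) * c (n - 1) (m + 3) k = -(((n : ℂ) - k) * 𝒟.B (n - 1) (m + 3)) * c n m k)
    (v u : 𝒟.V) :
    𝒟.weightForm (𝒟.labelWeight c) (𝒟.Xab v) u
      = (suSign 0 * suSign 2) * 𝒟.weightForm (𝒟.labelWeight c) v (𝒟.Yab u) := by
  refine 𝒟.weightForm_comm_of_entries _ 𝒟.Xab 𝒟.Yab _ (fun s t => ?_) v u
  obtain ⟨⟨n, m, k⟩, hS, hk1, hkn⟩ := s
  obtain ⟨⟨n', m', k'⟩, hS', hk1', hkn'⟩ := t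
  dsimp only at hS hk1 hkn hS' hk1' hkn'
  rw [← vec_of_pos n m k ⟨hS, hk1, hkn⟩, ← vec_of_pos n' m' k' ⟨hS', hk1', hkn'⟩, Xab_entry,
    Yab_entry n' m' hk1', labelWeight_mk, labelWeight_mk, suSign_zero, suSign_two, one_mul]
  split_ifs
  any_goals (exfalso; omega)
  · -- the `A`–`D` edge `(n,m,k) → (n+1,m+3,k)`
    obtain ⟨e1, e2, e3⟩ : n' = n + 1 ∧ m' = m + 3 ∧ k' = k := by assumption
    subst n' m' k'
    have e := hAD n m k hS hS' hk1 hkn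
    rw [add_zero, zero_add, map_mul, map_sub, map_add, map_one, map_intCast, map_intCast]
    linear_combination e
  · -- the `B`–`C` edge `(n,m,k) → (n-1,m+3,k-1)`
    obtain ⟨e1, e2, e3⟩ : n' = n - 1 ∧ m' = m + 3 ∧ k' = k - 1 := by assumption
    subst n' m' k'
    have e := hBC n m (k - 1) hS hS' hk1' hkn'
    have e' := hk_complex hk hS hk1' (by omega)
    rw [sub_add_cancel] at e'
    rw [zero_add, add_zero, map_mul, map_sub, map_one, map_intCast]
    push_cast at e e' ⊢
    linear_combination ((k : ℂ) - 1) * e + 𝒟.B (n - 1) (m + 3) * e'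
  · simp

/-- `E₁₂ ↦ X_β`, `E₂₁ ↦ Y_β`: `⟨X_β v, w⟩_c = -⟨v, Y_β w⟩_c` from the two edge conditions (and the
`𝔨`-condition) [cite: Kovacevic2021, §4 proof of Thm 4] -/
theorem weightForm_Xb_comm
    (hk : ∀ n m k, (n, m) ∈ 𝒟.S → 1 ≤ k → k < n → c n m (k + 1) = k * (n - k) * c n m k)
    (hAD : ∀ n m k, (n, m) ∈ 𝒟.S → (n + 1, m + 3) ∈ 𝒟.S → 1 ≤ k → k ≤ n →
      ((n : ℂ) + 1 - k) * starRingEnd ℂ (𝒟.A n m) * c (n + 1) (m + 3) k = -𝒟.D (n + 1) (m + 3) * c n m k)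
    (hBC : ∀ n m k, (n, m) ∈ 𝒟.S → (n - 1, m + 3) ∈ 𝒟.S → 1 ≤ k → k ≤ n - 1 →
      starRingEnd ℂ (𝒟.C n m) * c (n - 1) (m + 3) k = -(((n : ℂ) - k) * 𝒟.B (n - 1) (m + 3)) * c n m k)
    (v u : 𝒟.V) :
    𝒟.weightForm (𝒟.labelWeight c) (𝒟.Xb v) u
      = (suSign 1 * suSign 2) * 𝒟.weightForm (𝒟.labelWeight c) v (𝒟.Yb u) := by
  refine 𝒟.weightForm_comm_of_entries _ 𝒟.Xb 𝒟.Yb _ (fun s t => ?_) v u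
  obtain ⟨⟨n, m, k⟩, hS, hk1, hkn⟩ := s
  obtain ⟨⟨n', m', k'⟩, hS', hk1', hkn'⟩ := t
  dsimp only at hS hk1 hkn hS' hk1' hkn'
  rw [← vec_of_pos n m k ⟨hS, hk1, hkn⟩, ← vec_of_pos n' m' k' ⟨hS', hk1', hkn'⟩, Xb_entry n m hk1,
    Yb_entry, labelWeight_mk, labelWeight_mk, suSign_one, suSign_two, one_mul]
  split_ifs
  any_goals (exfalso; omega)
  · -- the `A`–`D` edge `(n,m,k) → (n+1,m+3,k+1)`
    obtain ⟨e1, e2, e3⟩ : n' = n + 1 ∧ m' = m + 3 ∧ k' = k + 1 := by assumption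
    subst n' m' k'
    have e := hAD n m k hS hS' hk1 hkn
    have e' := hk_complex hk hS' hk1 (by omega)
    rw [add_zero, zero_add, map_neg]
    push_cast at e e' ⊢
    linear_combination (-(starRingEnd ℂ (𝒟.A n m))) * e' + (-(k : ℂ)) * e
  · -- the `B`–`C` edge `(n,m,k) → (n-1,m+3,k)`
    obtain ⟨e1, e2, e3⟩ : n' = n - 1 ∧ m' = m + 3 ∧ k' = k := by assumption
    subst n' m' k'
    have e := hBC n m k hS hS' hk1 hkn'
    rw [zero_add, add_zero]
    push_cast at e ⊢
    linear_combination e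
  · simp

/-- the diagonal operators `a H_α + b H_β` (`a, b` real) are self-adjoint for any weighted form
[cite: Kovacevic2021, §4 proof of Thm 4] -/
theorem weightForm_diag_comm (w : 𝒟.Idx → ℝ) (a b : ℝ) (v u : 𝒟.V) :
    𝒟.weightForm w (((a : ℂ) • 𝒟.Ha + (b : ℂ) • 𝒟.Hb) v) u
      = 1 * 𝒟.weightForm w v (((a : ℂ) • 𝒟.Ha + (b : ℂ) • 𝒟.Hb) u) := by
  refine 𝒟.weightForm_comm_of_entries _ _ _ _ (fun s t => ?_) v u
  obtain ⟨⟨n, m, k⟩, hS, hk1, hkn⟩ := s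
  obtain ⟨⟨n', m', k'⟩, hS', hk1', hkn'⟩ := t
  dsimp only at hS hk1 hkn hS' hk1' hkn'
  rw [← vec_of_pos n m k ⟨hS, hk1, hkn⟩, ← vec_of_pos n' m' k' ⟨hS', hk1', hkn'⟩, diag_entry, diag_entry,
    one_mul]
  split_ifs
  any_goals (exfalso; omega)
  · obtain ⟨e1, e2, e3⟩ : n' = n ∧ m' = m ∧ k' = k := by assumption
    subst n' m' k'
    simp only [map_add, map_mul, map_sub, map_div₀, map_one, map_intCast, map_ofNat, Complex.conj_ofReal]
    ring
  · simp

/-- `E₀₁ ↦ X_α` [cite: Kovacevic2021, §3] -/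
private theorem ρfun_E01 : 𝒟.ρfun (E 0 1) = 𝒟.Xa := 𝒟.ρfun_E 0 1
/-- `E₁₀ ↦ Y_α` [cite: Kovacevic2021, §3] -/
private theorem ρfun_E10 : 𝒟.ρfun (E 1 0) = 𝒟.Ya := 𝒟.ρfun_E 1 0
/-- `E₀₂ ↦ X_{α+β}` [cite: Kovacevic2021, §3] -/
private theorem ρfun_E02 : 𝒟.ρfun (E 0 2) = 𝒟.Xab := 𝒟.ρfun_E 0 2
/-- `E₂₀ ↦ Y_{α+β}` [cite: Kovacevic2021, §3] -/
private theorem ρfun_E20 : 𝒟.ρfun (E 2 0) = 𝒟.Yab := 𝒟.ρfun_E 2 0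
/-- `E₁₂ ↦ X_β` [cite: Kovacevic2021, §3] -/
private theorem ρfun_E12 : 𝒟.ρfun (E 1 2) = 𝒟.Xb := 𝒟.ρfun_E 1 2
/-- `E₂₁ ↦ Y_β` [cite: Kovacevic2021, §3] -/
private theorem ρfun_E21 : 𝒟.ρfun (E 2 1) = 𝒟.Yb := 𝒟.ρfun_E 2 1
/-- `E₀₀ ↦ (2/3) H_α + (1/3) H_β` [cite: Kovacevic2021, §3] -/
private theorem ρfun_E00 : 𝒟.ρfun (E 0 0) = ((2 / 3 : ℝ) : ℂ) • 𝒟.Ha + ((1 / 3 : ℝ) : ℂ) • 𝒟.Hb := by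
  rw [show ((2 / 3 : ℝ) : ℂ) = 2 / 3 by push_cast; ring, show ((1 / 3 : ℝ) : ℂ) = 1 / 3 by push_cast; ring]
  exact 𝒟.ρfun_E 0 0
/-- `E₁₁ ↦ -(1/3) H_α + (1/3) H_β` [cite: Kovacevic2021, §3] -/
private theorem ρfun_E11 : 𝒟.ρfun (E 1 1) = ((-1 / 3 : ℝ) : ℂ) • 𝒟.Ha + ((1 / 3 : ℝ) : ℂ) • 𝒟.Hb := by
  rw [show ((-1 / 3 : ℝ) : ℂ) = -1 / 3 by push_cast; ring, show ((1 / 3 : ℝ) : ℂ) = 1 / 3 by push_cast; ring]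
  exact 𝒟.ρfun_E 1 1
/-- `E₂₂ ↦ -(1/3) H_α - (2/3) H_β` [cite: Kovacevic2021, §3] -/
private theorem ρfun_E22 : 𝒟.ρfun (E 2 2) = ((-1 / 3 : ℝ) : ℂ) • 𝒟.Ha + ((-2 / 3 : ℝ) : ℂ) • 𝒟.Hb := by
  rw [show ((-1 / 3 : ℝ) : ℂ) = -1 / 3 by push_cast; ring,
    show ((-2 / 3 : ℝ) : ℂ) = -2 / 3 by push_cast; ring]
  exact 𝒟.ρfun_E 2 2

/-- **Invariance of the weighted form**: under the three recursions, `⟨E_{ij} v, w⟩_c = ε_i ε_j ⟨v, E_{ji} w⟩_c`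
for all nine matrix units (`𝔰𝔲(2,1)` acts by skew-adjoint operators). [cite: Kovacevic2021, §4 proof of Thm 4] -/
theorem weightForm_lie_comm
    (hk : ∀ n m k, (n, m) ∈ 𝒟.S → 1 ≤ k → k < n → c n m (k + 1) = k * (n - k) * c n m k)
    (hAD : ∀ n m k, (n, m) ∈ 𝒟.S → (n + 1, m + 3) ∈ 𝒟.S → 1 ≤ k → k ≤ n →
      ((n : ℂ) + 1 - k) * starRingEnd ℂ (𝒟.A n m) * c (n + 1) (m + 3) k = -𝒟.D (n + 1) (m + 3) * c n m k)
    (hBC : ∀ n m k, (n, m) ∈ 𝒟.S → (n - 1, m + 3) ∈ 𝒟.S → 1 ≤ k → k ≤ n - 1 →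
      starRingEnd ℂ (𝒟.C n m) * c (n - 1) (m + 3) k = -(((n : ℂ) - k) * 𝒟.B (n - 1) (m + 3)) * c n m k)
    (i j : Fin 3) (v u : 𝒟.V) :
    𝒟.weightForm (𝒟.labelWeight c) ⁅E i j, v⁆ u
      = suSign i * suSign j * 𝒟.weightForm (𝒟.labelWeight c) v ⁅E j i, u⁆ := by
  have c00 : ∀ v u : 𝒟.V, 𝒟.weightForm (𝒟.labelWeight c) ⁅E 0 0, v⁆ u
      = suSign 0 * suSign 0 * 𝒟.weightForm (𝒟.labelWeight c) v ⁅E 0 0, u⁆ := fun v u => by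
    rw [lie_def, lie_def, ρfun_E00, suSign_zero, one_mul]
    exact weightForm_diag_comm _ _ _ v u
  have c11 : ∀ v u : 𝒟.V, 𝒟.weightForm (𝒟.labelWeight c) ⁅E 1 1, v⁆ u
      = suSign 1 * suSign 1 * 𝒟.weightForm (𝒟.labelWeight c) v ⁅E 1 1, u⁆ := fun v u => by
    rw [lie_def, lie_def, ρfun_E11, suSign_one, one_mul]
    exact weightForm_diag_comm _ _ _ v u
  have c22 : ∀ v u : 𝒟.V, 𝒟.weightForm (𝒟.labelWeight c) ⁅E 2 2, v⁆ u
      = suSign 2 * suSign 2 * 𝒟.weightForm (𝒟.labelWeight c) v ⁅E 2 2, u⁆ := fun v u => by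
    rw [lie_def, lie_def, ρfun_E22, suSign_two, show (-1 : ℂ) * -1 = 1 by ring]
    exact weightForm_diag_comm _ _ _ v u
  have c01 : ∀ v u : 𝒟.V, 𝒟.weightForm (𝒟.labelWeight c) ⁅E 0 1, v⁆ u
      = suSign 0 * suSign 1 * 𝒟.weightForm (𝒟.labelWeight c) v ⁅E 1 0, u⁆ := fun v u => by
    rw [lie_def, lie_def, ρfun_E01, ρfun_E10]
    exact weightForm_Xa_comm hk v u
  have c02 : ∀ v u : 𝒟.V, 𝒟.weightForm (𝒟.labelWeight c) ⁅E 0 2, v⁆ u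
      = suSign 0 * suSign 2 * 𝒟.weightForm (𝒟.labelWeight c) v ⁅E 2 0, u⁆ := fun v u => by
    rw [lie_def, lie_def, ρfun_E02, ρfun_E20]
    exact weightForm_Xab_comm hk hAD hBC v u
  have c12 : ∀ v u : 𝒟.V, 𝒟.weightForm (𝒟.labelWeight c) ⁅E 1 2, v⁆ u
      = suSign 1 * suSign 2 * 𝒟.weightForm (𝒟.labelWeight c) v ⁅E 2 1, u⁆ := fun v u => by
    rw [lie_def, lie_def, ρfun_E12, ρfun_E21]
    exact weightForm_Xb_comm hk hAD hBC v u
  have c10 := weightForm_lie_comm_symm _ c01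
  have c20 := weightForm_lie_comm_symm _ c02
  have c21 := weightForm_lie_comm_symm _ c12
  fin_cases i <;> fin_cases j
  exacts [c00 v u, c01 v u, c02 v u, c10 v u, c11 v u, c12 v u, c20 v u, c21 v u, c22 v u]

/-- **Unitarizability criterion.** If positive weights `c(n,m,k)` on the admissible labels of a datum satisfy
the `𝔨`-condition `c(n,m,k+1) = k(n-k)c(n,m,k)`, the `A`–`D` edge condition
`(n+1-k) conj(A_{n,m}) c(n+1,m+3,k) = -D_{n+1,m+3} c(n,m,k)` and the `B`–`C` edge condition
`conj(C_{n,m}) c(n-1,m+3,k) = -(n-k) B_{n-1,m+3} c(n,m,k)`, then the weighted Hermitian form `⟨·,·⟩_c` is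
positive definite and `𝔰𝔲(2,1)`-invariant: the datum is unitarizable.  (Kovačević: "the form is positive iff
`a d < 0` and `b c < 0`".) [cite: Kovacevic2021, §4 Thm 4 (proof)] [cite: BorelWallach2000, VI Thm 4.12 (2)] -/
theorem isUnitarizable_of_weights (𝒟 : SU21Datum) (c : ℤ → ℤ → ℤ → ℝ)
    (hpos : ∀ n m k, (n, m) ∈ 𝒟.S → 1 ≤ k → k ≤ n → 0 < c n m k)
    (hk : ∀ n m k, (n, m) ∈ 𝒟.S → 1 ≤ k → k < n → c n m (k + 1) = k * (n - k) * c n m k)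
    (hAD : ∀ n m k, (n, m) ∈ 𝒟.S → (n + 1, m + 3) ∈ 𝒟.S → 1 ≤ k → k ≤ n →
      ((n : ℂ) + 1 - k) * starRingEnd ℂ (𝒟.A n m) * c (n + 1) (m + 3) k = -𝒟.D (n + 1) (m + 3) * c n m k)
    (hBC : ∀ n m k, (n, m) ∈ 𝒟.S → (n - 1, m + 3) ∈ 𝒟.S → 1 ≤ k → k ≤ n - 1 →
      starRingEnd ℂ (𝒟.C n m) * c (n - 1) (m + 3) k = -(((n : ℂ) - k) * 𝒟.B (n - 1) (m + 3)) * c n m k) :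
    IsUnitarizable 𝒟 := by
  refine ⟨𝒟.weightForm (𝒟.labelWeight c), 𝒟.weightForm_conj_symm _,
    fun v hv => 𝒟.weightForm_self_pos _ (fun t => ?_) hv, weightForm_lie_comm hk hAD hBC⟩
  obtain ⟨⟨n, m, k⟩, hS, hk1, hkn⟩ := t
  exact hpos n m k hS hk1 hkn

end SU21Datum

end Literature.RepresentationTheory.Kovacevic2021
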